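import Literature.NumberTheory.Sieve.HeathBrownMorozClassApprox
import HarnessLib

/-!
# Heath-Brown–Moroz 2004, Lemma 3.3 (= Heath-Brown's Lemma 3.7 for the class family), III: assembly

Sequel of `HeathBrownMorozClassUpperBounds` / `HeathBrownMorozClassApprox`. D. R. Heath-Brown and
B. Z. Moroz, Proc. LMS (3) 88 (2004) 289–312 [HeathBrownMoroz2004], Lemma 3.3 (p. 18 of the render) =
[HeathBrownActa2001, Lemma 3.7] for the class sequence. Contents:

* `U_sub_bounds` — the three `U`-lines of Lemma 3.7 for every subfamily `E' ⊆ 𝒜^(K)` (template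
  `U_A_bounds`, from `U_sub_sum_bound`);
* **`HeathBrownMoroz2004_lemma_3_3`** — the five `𝒜`-side bounds of Lemma 3.7 of [3] for every subfamily
  `E' ⊆ 𝒜^(K)` (in particular `classPairs X η d a b`), with ONE constant; the `ℬ`-side is Heath-Brown's
  own (`HeathBrown2001_lemma_3_7_holds`), the comparison family `ℬ` being unchanged for the class.

## References

* [HeathBrownMoroz2004] §3, Lemma 3.3, pp. 18–19. [cite: HeathBrownMoroz2004, Lemma 3.3]
* [HeathBrownActa2001] D. R. Heath-Brown, Acta Math. 186 (2001), Lemma 3.7. [cite: HeathBrownActa2001, Lemma 3.7]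

## Mathlib / tree search

Tree: `U_sub_sum_bound`, `U2_sub_bound` (part II), `S4_sub_bound` (part I), `Upiece_eq_U1piece`
(`HeathBrownCubicApproxUSum`), `lemma_3_7_scales_nonneg` (`HeathBrownCubicApproxAssembly`).
-/

noncomputable section

open Polynomial NumberField Finset Filter Topology Asymptotics
open scoped nonZeroDivisors

namespace Literature.NumberTheory.Sieve.CubicSieve

open LFunctions.CubeRootTwoField CubicPrimes

open scoped Classical in
/-- **Lemma 3.7, the three `U`-lines, for every subfamily `E' ⊆ 𝒜^(K)`** (template `U_A_bounds`).
[cite: HeathBrownMoroz2004, Lemma 3.3] -/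
theorem U_sub_bounds {ϖ : ℝ} (hϖ0 : 0 < ϖ) (hϖ1 : ϖ < 1 / 5) :
    ∃ C X₀ : ℝ, ∀ X η : ℝ, X₀ ≤ X → Real.exp (-Real.log X ^ (1 / 3 : ℝ)) ≤ η → η ≤ 1 →
      ∀ E' : Finset (ℕ × ℕ), E' ⊆ boxPairs X η →
      (∑ n ∈ Icc 3 (chainBound (hbTau ϖ X)),
          |(Upiece E' pairIdeal X (hbTau ϖ X) n : ℝ) - Uhat X (hbTau ϖ X) E' pairIdeal n| ≤
        C * (hbXi (hbTau ϖ X) / hbTau ϖ X ^ 4) * (η ^ 2 * X ^ 2 / Real.log X)) ∧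
      (|(U1piece E' pairIdeal X (hbTau ϖ X) 1 : ℝ) - Uhat X (hbTau ϖ X) E' pairIdeal 1| ≤
        C * (hbXi (hbTau ϖ X) / hbTau ϖ X ^ 4) * (η ^ 2 * X ^ 2 / Real.log X)) ∧
      (|(U1piece E' pairIdeal X (hbTau ϖ X) 2 : ℝ) - Uhat X (hbTau ϖ X) E' pairIdeal 2| ≤
        C * (hbXi (hbTau ϖ X) / hbTau ϖ X ^ 4) * (η ^ 2 * X ^ 2 / Real.log X)) := by
  obtain ⟨C, X₀, h⟩ := U_sub_sum_bound hϖ0 hϖ1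
  refine ⟨C, X₀, fun X η hX hη hη1 E' hE' => ?_⟩
  obtain ⟨hX1, hτ0, hτ40, hsum⟩ := h X η hX hη hη1 E' hE'
  set τ := hbTau ϖ X with hτ
  set N := chainBound τ with hN
  have hnonneg : ∀ n ∈ Icc 1 N, 0 ≤ |(U1piece E' pairIdeal X τ n : ℝ) - Uhat X τ E' pairIdeal n| :=
    fun _ _ => abs_nonneg _
  have hN2 : 2 ≤ N := by
    rw [hN, chainBound]
    have : 1 ≤ ⌊1 / τ⌋₊ := Nat.le_floor (by
      rw [Nat.cast_one, le_div_iff₀ hτ0]; linarith)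
    omega
  refine ⟨?_, ?_, ?_⟩
  · calc ∑ n ∈ Icc 3 N, |(Upiece E' pairIdeal X τ n : ℝ) - Uhat X τ E' pairIdeal n|
        = ∑ n ∈ Icc 3 N, |(U1piece E' pairIdeal X τ n : ℝ) - Uhat X τ E' pairIdeal n| := by
          refine sum_congr rfl fun n hn => ?_
          rw [Upiece_eq_U1piece E' pairIdeal hX1 hτ0 (by linarith) (mem_Icc.mp hn).1]
      _ ≤ ∑ n ∈ Icc 1 N, |(U1piece E' pairIdeal X τ n : ℝ) - Uhat X τ E' pairIdeal n| :=
          sum_le_sum_of_subset_of_nonneg (fun n hn => by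
            rw [mem_Icc] at hn ⊢; omega) fun n _ _ => abs_nonneg _
      _ ≤ _ := hsum
  · have h1 : 1 ∈ Icc 1 N := by rw [mem_Icc]; omega
    exact (single_le_sum hnonneg h1).trans hsum
  · have h2 : 2 ∈ Icc 1 N := by rw [mem_Icc]; omega
    exact (single_le_sum hnonneg h2).trans hsum

open scoped Classical in
/-- **Heath-Brown–Moroz 2004, Lemma 3.3, `𝒜`-side** (= [3, Lemma 3.7] for the class): for every
`ϖ ∈ (0, 1/5)` there are `C, X₀` such that for `X ≥ X₀`, `η` in (2.1), and EVERY subfamily `E' ⊆ 𝒜^(K)` —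
in particular the class family `classPairs X η d a b` of any `(d, a, b)` — the five approximation errors
`∑_{n≥3}|U^(n) − Û^(n)|`, `|U₁^(1) − Û₁^(1)|`, `|U₁^(2) − Û₁^(2)|`, `|S₄ − Ŝ₄|`, `|U₂^(1) − Û₂^(1)|` of `E'`
are `≤ C ξτ^{-4} η²X²/log X` (`τ = (log log X)^{-ϖ}`, `ξ = τ⁵`). The `ℬ`-side of Lemma 3.7 is unchanged
(`HeathBrown2001_lemma_3_7_holds`). [cite: HeathBrownMoroz2004, Lemma 3.3] -/
theorem HeathBrownMoroz2004_lemma_3_3 :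
    ∀ ϖ : ℝ, 0 < ϖ → ϖ < 1 / 5 →
      ∃ C X₀ : ℝ, ∀ X η : ℝ, X₀ ≤ X → Real.exp (-Real.log X ^ (1 / 3 : ℝ)) ≤ η → η ≤ 1 →
        ∀ E' : Finset (ℕ × ℕ), E' ⊆ boxPairs X η →
        (∑ n ∈ Icc 3 (chainBound (hbTau ϖ X)),
            |(Upiece E' pairIdeal X (hbTau ϖ X) n : ℝ) - Uhat X (hbTau ϖ X) E' pairIdeal n| ≤
          C * (hbXi (hbTau ϖ X) / hbTau ϖ X ^ 4) * (η ^ 2 * X ^ 2 / Real.log X)) ∧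
        (|(U1piece E' pairIdeal X (hbTau ϖ X) 1 : ℝ) - Uhat X (hbTau ϖ X) E' pairIdeal 1| ≤
          C * (hbXi (hbTau ϖ X) / hbTau ϖ X ^ 4) * (η ^ 2 * X ^ 2 / Real.log X)) ∧
        (|(U1piece E' pairIdeal X (hbTau ϖ X) 2 : ℝ) - Uhat X (hbTau ϖ X) E' pairIdeal 2| ≤
          C * (hbXi (hbTau ϖ X) / hbTau ϖ X ^ 4) * (η ^ 2 * X ^ 2 / Real.log X)) ∧
        (|(S₄ E' pairIdeal X (hbTau ϖ X) : ℝ) - S4hat X (hbTau ϖ X) E' pairIdeal| ≤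
          C * (hbXi (hbTau ϖ X) / hbTau ϖ X ^ 4) * (η ^ 2 * X ^ 2 / Real.log X)) ∧
        (|(U2one E' pairIdeal X (hbTau ϖ X) : ℝ) - U2hat X (hbTau ϖ X) E' pairIdeal| ≤
          C * (hbXi (hbTau ϖ X) / hbTau ϖ X ^ 4) * (η ^ 2 * X ^ 2 / Real.log X)) := by
  intro ϖ hϖ0 hϖ1
  obtain ⟨C₁, X₁, h1⟩ := S4_sub_bound hϖ0 hϖ1
  obtain ⟨C₃, X₃, h3⟩ := U_sub_bounds hϖ0 hϖ1
  obtain ⟨C₅, X₅, h5⟩ := U2_sub_bound hϖ0 hϖ1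
  set C := max (max C₁ C₃) C₅ with hC
  refine ⟨C, max (max (max X₁ X₃) X₅) 16, fun X η hX hη hη1 E' hE' => ?_⟩
  have hX1 : X₁ ≤ X := le_trans (le_trans (le_trans (le_max_left _ _) (le_max_left _ _)) (le_max_left _ _)) hX
  have hX3 : X₃ ≤ X := le_trans (le_trans (le_trans (le_max_right _ _) (le_max_left _ _)) (le_max_left _ _)) hX
  have hX5 : X₅ ≤ X := le_trans (le_trans (le_max_right _ _) (le_max_left _ _)) hX
  have hX16 : (16 : ℝ) ≤ X := le_trans (le_max_right _ _) hX
  have hη0 : 0 ≤ η := (Real.exp_pos _).le.trans hη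
  obtain ⟨hs, -⟩ := lemma_3_7_scales_nonneg (ϖ := ϖ) hX16 hη0
  have hC1 : C₁ ≤ C := (le_max_left _ _).trans (le_max_left _ _)
  have hC3 : C₃ ≤ C := (le_max_right _ _).trans (le_max_left _ _)
  have hC5 : C₅ ≤ C := le_max_right _ _
  obtain ⟨a, b, c⟩ := h3 X η hX3 hη hη1 E' hE'
  have k : ∀ {C' : ℝ}, C' ≤ C → C' * (hbXi (hbTau ϖ X) / hbTau ϖ X ^ 4) * (η ^ 2 * X ^ 2 / Real.log X) ≤
      C * (hbXi (hbTau ϖ X) / hbTau ϖ X ^ 4) * (η ^ 2 * X ^ 2 / Real.log X) := fun hC' => by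
    rw [mul_assoc, mul_assoc]; exact mul_le_mul_of_nonneg_right hC' hs
  exact ⟨a.trans (k hC3), b.trans (k hC3), c.trans (k hC3), (h1 X η hX1 hη hη1 E' hE').trans (k hC1),
    (h5 X η hX5 hη hη1 E' hE').trans (k hC5)⟩

end Literature.NumberTheory.Sieve.CubicSieve

end
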